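import Summits.HodgeConjecture.CorCM.Census.TwistScrewUp
import Summits.HodgeConjecture.CorCM.Census.TwistGenerationLaw

/-!
# Uniform twist generation, XIV: THE SCREW TYPE — screw profiles, the tied arc type fixed by `θ⁻¹(1, t)`, and its one-row covering face

COR-CM (cell `pub-hodgecm2`), count-neutral kernel combinatorics by the binder seat b09 (gen 37; lane UNIFORM TWIST GENERATION, part XIV), on
parts II, X–XI (`cst`, `ddist`, `pot`; `arcTy`, `upCl`, the upper-class calculus) used BY NAME; the screw profile is seat b09ʼs quartic
construction `Census/QuarticTwistScrew.exists_screw` (gen 32) run modulo `2n`.  Theorems only: no definition, no `decide`, no certificate, no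
named fact, no `sorry`.
HONEST FRAMING: `HC_CM` is NOT proved, here or anywhere in the tree; nothing here is a period or a headline.

Along a datum `θ : G ≃ ℤ/2n × B` (`θ (PQ) = θ P + θ Q`, `θ c = (n, 0)`):
* §1 **screw profiles** (`exists_screw_profile`): if `2n ∣ ord t` there is `s : B → ℤ/2n` with `s (b + t) = s b + 1` (number every coset of `⟨t⟩`
  along `t` and reduce modulo `2n`);
* §2 **the screw type** `ψ = arcTy s` is fixed by the base change along `Q = θ⁻¹(1, t)` (`rt_arcTy_of_screw`), hence TIED — every centre
  realises its potential (`tied_of_rt_eq`: the distances to `cst a'` and `cst (a' + 1)` agree, so all agree);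
* §3 **the screw data** (`exists_screw_data`, `n ≥ 2`): the screw type `ψ`, its symmetry `Q`, a row `x = s 0 + n + 1` and the two distinct
  deviation places `p = θ⁻¹(x, 0)`, `q = θ⁻¹(x, t)` of `cst x ∖ ψ` IN ONE ROW; and **the corners of the one-row face lie in the upper class
  `upCl x`** (`screw_corners_up`: single flips of a tied type, part XI, then flip closure) — so the face `gface ψ p q` both lowers the potential
  (it is a legitimate covering face of `ψ`ʼs block, part XII) and yields the star form `[ψ] ≡ θ_{cst x}(typeSum [ψ])` (part XV).

## References
* [Pohlmann1968] H. Pohlmann, Algebraic cycles on abelian varieties of complex multiplication type, Ann. of Math. 88 (1968), Thm 1.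
* [Milne1999] J. S. Milne, Lefschetz motives and the Tate conjecture, Compositio Math. 117 (1999), Prop. 2.1, p. 54.
-/

namespace Summit.HodgeConjecture.CorCM.Census.TwistGeneration

open Finset
open Summit.HodgeConjecture.CorCM.Prior.AllgGroup.RfwfAllgGroup
open Summit.HodgeConjecture.CorCM.Census.BlockParity
open Summit.HodgeConjecture.CorCM.Census.Coinvariant

noncomputable section

/-! ## §1 Screw profiles -/

section Profile

variable {B : Type} [AddGroup B] {n : ℕ}

/-- **Screw profiles exist when `2n ∣ ord t`**: there is `s : B → ℤ/2n` with `s (b + t) = s b + 1` for all `b` (number the elements of each coset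
`b + ⟨t⟩` along `t` from its representative and reduce modulo `2n`; consistent around the cycle because `2n ∣ ord t`). [folklore] -/
theorem exists_screw_profile {t : B} (ht : 2 * n ∣ addOrderOf t) : ∃ s : B → ZMod (2 * n), ∀ b : B, s (b + t) = s b + 1 := by
  classical
  obtain ⟨H, hH⟩ : ∃ H : AddSubgroup B, H = AddSubgroup.zmultiples t := ⟨_, rfl⟩
  have hk : ∀ x : B, ∃ k : ℤ, ((x : B ⧸ H).out : B) = x + k • t := by
    intro x
    obtain ⟨⟨m, hm⟩, e⟩ := QuotientAddGroup.mk_out_eq_mul H x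
    rw [hH, AddSubgroup.mem_zmultiples_iff] at hm
    obtain ⟨k, rfl⟩ := hm
    exact ⟨k, e⟩
  choose k hk using hk
  refine ⟨fun x => -((k x : ℤ) : ZMod (2 * n)), fun x => ?_⟩
  show -((k (x + t) : ℤ) : ZMod (2 * n)) = -((k x : ℤ) : ZMod (2 * n)) + 1
  have hq : ((x : B) : B ⧸ H) = ((x + t : B) : B ⧸ H) := by
    rw [QuotientAddGroup.eq, neg_add_cancel_left, hH]
    exact AddSubgroup.mem_zmultiples t
  have e1 := hk x
  rw [hq, hk (x + t), add_assoc] at e1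
  have e2 : (k x - (1 + k (x + t))) • t = 0 := by
    rw [sub_zsmul, add_zsmul, one_zsmul, ← add_left_cancel e1]
    simp
  have e3 : ((addOrderOf t : ℕ) : ℤ) ∣ k x - (1 + k (x + t)) := (addOrderOf_dvd_iff_zsmul_eq_zero).mpr e2
  have e4 : ((2 * n : ℕ) : ℤ) ∣ k x - (1 + k (x + t)) := dvd_trans (Int.natCast_dvd_natCast.mpr ht) e3
  have e5 := (ZMod.intCast_zmod_eq_zero_iff_dvd _ (2 * n)).mpr e4
  push_cast at e5
  rw [sub_eq_zero.mp e5]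
  ring

/-- An element of order divisible by `2n ≥ 2` is non-zero. [folklore] -/
theorem ne_zero_of_dvd_addOrderOf [NeZero n] {t : B} (ht : 2 * n ∣ addOrderOf t) : t ≠ 0 := by
  rintro rfl
  rw [addOrderOf_zero, Nat.dvd_one] at ht
  have := NeZero.ne n
  omega

end Profile

/-! ## §2 The screw type is tied -/

variable {G : Type*} [Group G] [Fintype G] [DecidableEq G] {c : G}
variable {B : Type} [AddGroup B]
variable {n : ℕ} [NeZero n] (θ : G ≃ ZMod (2 * n) × B)
variable (hθ : ∀ P Q : G, θ (P * Q) = θ P + θ Q) (hθc : θ c = (((n : ℕ) : ZMod (2 * n)), 0))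

/-- **The arc type of a screw profile is fixed by `θ⁻¹(1, t)`.** [folklore] -/
theorem rt_arcTy_of_screw {t : B} {s : B → ZMod (2 * n)} (hs : ∀ b : B, s (b + t) = s b + 1) :
    rt c (θ.symm (1, t)) (arcTy θ hθ hθc s) = arcTy θ hθ hθc s := by
  rw [rt_arcTy, Equiv.apply_symm_apply]
  congr 1
  funext b
  show s (b + t) - 1 = s b
  rw [hs, add_sub_cancel_right]

/-- **A type fixed by a base change of first coordinate `1` is tied**: every centre realises its potential. [folklore] -/
theorem tied_of_rt_eq {Ψ : CMF G c} {Q : G} (hQ : rt c Q Ψ = Ψ) (hQ1 : (θ Q).1 = 1) :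
    ∀ a' : ZMod (2 * n), ddist (cst θ hθ hθc a') Ψ = pot θ hθ hθc Ψ := by
  have step : ∀ a' : ZMod (2 * n), ddist (cst θ hθ hθc (a' + 1)) Ψ = ddist (cst θ hθ hθc a') Ψ := by
    intro a'
    have h := ddist_cst_rt θ hθ hθc Q Ψ a'
    rw [hQ, hQ1] at h
    exact h.symm
  have hall : ∀ (k : ℕ) (a' : ZMod (2 * n)), ddist (cst θ hθ hθc (a' + (k : ℕ))) Ψ = ddist (cst θ hθ hθc a') Ψ := by
    intro k
    induction k with
    | zero => intro a'; rw [Nat.cast_zero, add_zero]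
    | succ k ih => intro a'; rw [Nat.cast_succ, ← add_assoc, step, ih]
  have hconst : ∀ a' : ZMod (2 * n), ddist (cst θ hθ hθc a') Ψ = ddist (cst θ hθ hθc 0) Ψ := by
    intro a'
    have h := hall a'.val 0
    rwa [zero_add, ZMod.natCast_zmod_val] at h
  intro a'
  obtain ⟨a₀, ha₀⟩ := exists_pot_eq θ hθ hθc Ψ
  rw [ha₀, hconst a', hconst a₀]

/-! ## §3 The screw data and the corners of the one-row face -/

/-- **THE SCREW DATA** (`n ≥ 2`, `2n ∣ ord t`): a type `ψ` fixed by a base change `Q` with `(θQ).1 = 1`, hence tied, together with a row `x` and two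
distinct deviation places `p ≠ q` of `cst x ∖ ψ` in that row (`θ p = (x, 0)`, `θ q = (x, t)`), at distinct places. [folklore] -/
theorem exists_screw_data (hn : 2 ≤ n) {t : B} (ht : 2 * n ∣ addOrderOf t) :
    ∃ (ψ : CMF G c) (Q : G) (x : ZMod (2 * n)) (p q : G), rt c Q ψ = ψ ∧ (θ Q).1 = 1 ∧
      (∀ a' : ZMod (2 * n), ddist (cst θ hθ hθc a') ψ = pot θ hθ hθc ψ) ∧
      p ∈ (cst θ hθ hθc x).1 \ ψ.1 ∧ q ∈ (cst θ hθ hθc x).1 \ ψ.1 ∧ p ≠ q ∧ q ∉ orb c p ∧ (θ p).1 = x ∧ (θ q).1 = x := by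
  have h2n : n + 1 < 2 * n := by omega
  have ht0 : (0 : B) ≠ t := (ne_zero_of_dvd_addOrderOf ht).symm
  obtain ⟨s, hs⟩ := exists_screw_profile ht
  set x : ZMod (2 * n) := s 0 + ((n + 1 : ℕ) : ZMod (2 * n)) with hx
  have hQ := rt_arcTy_of_screw θ hθ hθc (c := c) hs
  refine ⟨arcTy θ hθ hθc s, θ.symm (1, t), x, θ.symm (x, 0), θ.symm (x, t), hQ, by rw [Equiv.apply_symm_apply],
    tied_of_rt_eq θ hθ hθc hQ (by rw [Equiv.apply_symm_apply]), ?_, ?_, ?_, ?_, by rw [Equiv.apply_symm_apply],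
    by rw [Equiv.apply_symm_apply]⟩
  · rw [mem_sdiff, symm_mem_arcTy, hx, add_sub_cancel_left, ZMod.val_cast_of_lt h2n]
    exact ⟨symm_self_mem_cst θ hθ hθc _ _, by omega⟩
  · rw [mem_sdiff, symm_mem_arcTy, show s t = s 0 + 1 by rw [← hs 0, zero_add], hx,
      show s 0 + ((n + 1 : ℕ) : ZMod (2 * n)) - (s 0 + 1) = ((n : ℕ) : ZMod (2 * n)) by push_cast; ring, val_n]
    exact ⟨symm_self_mem_cst θ hθ hθc _ _, lt_irrefl n⟩
  · intro h
    exact ht0 (congrArg Prod.snd (θ.symm.injective h))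
  · exact symm_not_mem_orb θ hθ hθc ht0 x x

/-- **The corners of the one-row face lie in the upper class of the row.**  For a tied `ψ` and distinct deviation places `p ≠ q` of `cst x ∖ ψ` with
`(θ p).1 = (θ q).1 = x`: `ψ^{(p)}, ψ^{(q)}, ψ^{(p)(q)} ∈ upCl x`. [folklore] -/
theorem screw_corners_up (hc2 : c * c = 1) {ψ : CMF G c} (hψ : ∀ a' : ZMod (2 * n), ddist (cst θ hθ hθc a') ψ = pot θ hθ hθc ψ)
    {x : ZMod (2 * n)} {p q : G} (hp : p ∈ (cst θ hθ hθc x).1 \ ψ.1) (hq : q ∈ (cst θ hθ hθc x).1 \ ψ.1) (hpq : p ≠ q)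
    (hpx : (θ p).1 = x) (hqx : (θ q).1 = x) :
    oflipCM c hc2 p ψ ∈ upCl θ hθ hθc x ∧ oflipCM c hc2 q ψ ∈ upCl θ hθ hθc x ∧ oflipCM c hc2 p (oflipCM c hc2 q ψ) ∈ upCl θ hθ hθc x := by
  have h1 := up_oflipCM_of_tied θ hθ hθc hc2 hψ (mem_sdiff.mp hp).2
  have h2 := up_oflipCM_of_tied θ hθ hθc hc2 hψ (mem_sdiff.mp hq).2
  rw [hpx] at h1
  rw [hqx] at h2
  refine ⟨h1, h2, up_oflipCM θ hθ hθc hc2 h2 ?_⟩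
  rw [dev_oflip c hc2 (mem_sdiff.mp hq).1 (mem_sdiff.mp hq).2]
  exact mem_erase.mpr ⟨hpq, hp⟩

end

end Summit.HodgeConjecture.CorCM.Census.TwistGeneration
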